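import Mathlib
import HarnessLib
import Summits.PneNP.PneNP.Theorems.CnfIdealGenLengthRankDefectRepresentationsBlockLaw

/-!
# Crux `RankDefectRepresentations` (stmt-PneNP-18923), line `phantom-kernel`: stub N1 `stub_quadraticWitness`

CALIBRATION OF THE CRUX (lead prover, 2026-08-27).  `RankDefectRepresentations` asks, for every exponent `c`, for
almost-representations `M` of the Boolean cube (axiom ranks `≤ t`) under which the clause product of a polynomial-size
unsatisfiable CNF has rank `> n^c · t`.  Here the inner predicate is proved for ALL `n` at QUADRATIC ratio, with
the explicit family `φ_n = {x_0}, …, {x_{n-1}}, {¬x_0 ∨ … ∨ ¬x_{n-1}}` (size `2n`): over `ℚ`, axiom ranks `≤ 4`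
and `rank P_{φ_n}(M) ≥ n² - n` — the refuter vet's "block witness" (item note 15:46Z, there checked by exact
arithmetic for `n ≤ 6` only), kernel-checked for every `n`.  Construction: blocks `ℚ²` indexed by the ORDERED pairs
`(i, j)`, `i ≠ j`; on block `(i, j)`: `M_i = p = diag(1,0)`, `M_j = q = ½[[1,1],[1,1]]`, all other `M_k = 1`; the
clause product is `W - W²` with `W = M_0 ⋯ M_{n-1}`, blockwise `pq - (pq)²` or `qp - (qp)²`, both non-zero, so
`rank ≥ #blocks = n² - n` (ranks add over blocks, `rank_blockDiagonal`); a commutator `[M_i, M_j]` lives on the two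
blocks `(i,j)`, `(j,i)` only, rank `≤ 4`.  So the crux restricted to exponents `c < 2` holds; its content is the
passage from `n²` to `n^{ω(1)}` (and by the block law, p578807, no block-diagonal construction achieves it).
No definitions are introduced (the gadget matrices are written out).
HONEST FRAMING: elementary; P ≠ NP is not moved; F-N2 is a FRONTIER formal rung.
-/

set_option linter.dupNamespace false -- `Summit.PneNP.PneNP.…`: summit = sub-problem name (D-0017)

namespace Summit.PneNP.PneNP.Theorems.CnfIdealGenLengthRankDefectRepresentationsQuadraticWitness

open Filter
open Literature.Computability.Complexity
open Literature.Computability.MetaComplexity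
open Literature.Computability.MetaComplexity.NCIPS
open Summit.PneNP.PneNP.Theorems.CnfIdealGenLength

/-! ### The 2×2 gadget `p = diag(1,0)`, `q = ½J` -/

/-- `p² = p`. [folklore] -/
theorem p_idem : (!![1, 0; 0, 0] : Matrix (Fin 2) (Fin 2) ℚ) * !![1, 0; 0, 0] = !![1, 0; 0, 0] := by
  ext i j; fin_cases i <;> fin_cases j <;> simp

/-- `q² = q`. [folklore] -/
theorem q_idem : (!![1/2, 1/2; 1/2, 1/2] : Matrix (Fin 2) (Fin 2) ℚ) * !![1/2, 1/2; 1/2, 1/2] =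
    !![1/2, 1/2; 1/2, 1/2] := by
  ext i j; fin_cases i <;> fin_cases j <;> simp <;> norm_num

/-- `pq - (pq)² ≠ 0`. [folklore] -/
theorem pq_sub_sq_ne_zero :
    (!![1, 0; 0, 0] : Matrix (Fin 2) (Fin 2) ℚ) * !![1/2, 1/2; 1/2, 1/2] -
      (!![1, 0; 0, 0] : Matrix (Fin 2) (Fin 2) ℚ) * !![1/2, 1/2; 1/2, 1/2] *
        ((!![1, 0; 0, 0] : Matrix (Fin 2) (Fin 2) ℚ) * !![1/2, 1/2; 1/2, 1/2]) ≠ 0 := by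
  intro h
  have := congrFun (congrFun h 0) 0
  simp at this
  norm_num at this

/-- `qp - (qp)² ≠ 0`. [folklore] -/
theorem qp_sub_sq_ne_zero :
    (!![1/2, 1/2; 1/2, 1/2] : Matrix (Fin 2) (Fin 2) ℚ) * !![1, 0; 0, 0] -
      (!![1/2, 1/2; 1/2, 1/2] : Matrix (Fin 2) (Fin 2) ℚ) * !![1, 0; 0, 0] *
        ((!![1/2, 1/2; 1/2, 1/2] : Matrix (Fin 2) (Fin 2) ℚ) * !![1, 0; 0, 0]) ≠ 0 := by
  intro h
  have := congrFun (congrFun h 0) 0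
  simp at this
  norm_num at this

/-! ### List products with one or two special factors -/

section ListProd

variable {α R : Type} [DecidableEq α] [Monoid R]

/-- A product whose only non-unit factor sits at `c`. [folklore] -/
theorem prod_map_one_special (l : List α) (c : α) (Y : R) (hl : l.Nodup) :
    (l.map fun k => if k = c then Y else 1).prod = if c ∈ l then Y else 1 := by
  induction l with
  | nil => simp
  | cons k l ih =>
    rw [List.map_cons, List.prod_cons, ih (List.nodup_cons.mp hl).2]
    by_cases hk : k = c
    · subst hk
      have : k ∉ l := (List.nodup_cons.mp hl).1
      simp [this]
    · have : (c ∈ k :: l) ↔ c ∈ l := by simp [Ne.symm hk]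
      simp [hk, this]

/-- With two special factors `X` (at `a`) and `Y` (at `c`), both present once, the product is `X * Y` or `Y * X`.
[folklore] -/
theorem prod_map_two_special (l : List α) (a c : α) (hac : a ≠ c) (X Y : R) (hl : l.Nodup)
    (ha : a ∈ l) (hc : c ∈ l) :
    (l.map fun k => if k = a then X else if k = c then Y else 1).prod = X * Y ∨
    (l.map fun k => if k = a then X else if k = c then Y else 1).prod = Y * X := by
  induction l with
  | nil => simp at ha
  | cons k l ih =>
    have hnd := List.nodup_cons.mp hl
    rw [List.map_cons, List.prod_cons]
    by_cases hka : k = a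
    · subst hka
      left
      have hcl : c ∈ l := by
        rcases List.mem_cons.mp hc with h | h
        · exact absurd h.symm hac
        · exact h
      have hrest : (l.map fun k' => if k' = k then X else if k' = c then Y else 1) =
          l.map fun k' => if k' = c then Y else 1 := by
        apply List.map_congr_left
        intro k' hk'
        have : k' ≠ k := fun h => hnd.1 (h ▸ hk')
        simp [this]
      rw [hrest, prod_map_one_special l c Y hnd.2, if_pos hcl]
      simp
    · by_cases hkc : k = c
      · subst hkc
        right
        have hal : a ∈ l := by
          rcases List.mem_cons.mp ha with h | h
          · exact absurd h.symm hka
          · exact h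
        have hrest : (l.map fun k' => if k' = a then X else if k' = k then Y else 1) =
            l.map fun k' => if k' = a then X else 1 := by
          apply List.map_congr_left
          intro k' hk'
          have : k' ≠ k := fun h => hnd.1 (h ▸ hk')
          simp [this]
        rw [hrest, prod_map_one_special l a X hnd.2, if_pos hal]
        simp [hka]
      · have hal : a ∈ l := by
          rcases List.mem_cons.mp ha with h | h
          · exact absurd h.symm hka
          · exact h
        have hcl : c ∈ l := by
          rcases List.mem_cons.mp hc with h | h
          · exact absurd h.symm hkc
          · exact h
        simp only [hka, hkc, if_false, one_mul]
        exact ih hnd.2 hal hcl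

end ListProd

/-- A non-zero matrix has rank `≥ 1`. [folklore] -/
theorem one_le_rank_of_ne_zero {m : Type} [Fintype m] [DecidableEq m] {A : Matrix m m ℚ} (hA : A ≠ 0) :
    1 ≤ A.rank := by
  rw [Nat.one_le_iff_ne_zero]
  intro h0
  apply hA
  have hr : LinearMap.range A.mulVecLin = ⊥ := Submodule.finrank_eq_zero.mp h0
  have hlin : A.mulVecLin = 0 := LinearMap.range_eq_bot.mp hr
  have : Matrix.toLin' A = Matrix.toLin' 0 := by rw [map_zero]; exact hlin
  exact Matrix.toLin'.injective this

/-! ### The witness -/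

/-- STUB N1 `stub_quadraticWitness` of the line `phantom-kernel` (registered signature, verbatim): the crux's inner
predicate at quadratic ratio for every `n` — axiom ranks `≤ 4`, `rank P_{φ_n}(M) ≥ n² - n` for
`φ_n = {x_0}, …, {x_{n-1}}, {¬x_0 ∨ … ∨ ¬x_{n-1}}`. [folklore] -/
theorem stub_quadraticWitness :
    ∃ C : ℕ, ∀ n : ℕ, ∃ (K : Type) (_ : Field K) (_ : CharZero K) (d t : ℕ)
      (M : Fin n → Matrix (Fin d) (Fin d) K),
      (∀ g : MonoidAlgebra K (FreeMonoid (Fin n)), IsAxiom g →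
        (MonoidAlgebra.lift K (Matrix (Fin d) (Fin d) K) (FreeMonoid (Fin n)) (FreeMonoid.lift M) g).rank
          ≤ t) ∧
      t ≤ C ∧
      n * n ≤ C * ((MonoidAlgebra.lift K (Matrix (Fin d) (Fin d) K) (FreeMonoid (Fin n)) (FreeMonoid.lift M)
        (clauseProduct K (((List.finRange n).map fun i => [(i, true)]) ++
          [(List.finRange n).map fun i => (i, false)]))).rank + n) := by
  refine ⟨4, fun n => ?_⟩
  classical
  -- blocks: ordered pairs of distinct variables
  let o : Type := ↥((Finset.univ : Finset (Fin n)).offDiag)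
  have hcard : Fintype.card o = n * n - n := by
    simp only [o, Fintype.card_coe, Finset.offDiag_card, Finset.card_univ, Fintype.card_fin]
  have hne : ∀ b : o, b.1.1 ≠ b.1.2 := fun b => (Finset.mem_offDiag.mp b.2).2.2
  -- the gadget
  let p : Matrix (Fin 2) (Fin 2) ℚ := !![1, 0; 0, 0]
  let q : Matrix (Fin 2) (Fin 2) ℚ := !![1/2, 1/2; 1/2, 1/2]
  let B : Fin n → o → Matrix (Fin 2) (Fin 2) ℚ := fun i b =>
    if i = b.1.1 then p else if i = b.1.2 then q else 1
  have hBidem : ∀ i b, B i b * B i b = B i b := by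
    intro i b
    simp only [B]
    split_ifs
    · exact p_idem
    · exact q_idem
    · simp
  have hBone : ∀ i (b : o), i ≠ b.1.1 → i ≠ b.1.2 → B i b = 1 := by
    intro i b h1 h2; simp [B, h1, h2]
  let d : ℕ := Fintype.card (Fin 2 × o)
  let e : Fin 2 × o ≃ Fin d := Fintype.equivFin _
  let M : Fin n → Matrix (Fin d) (Fin d) ℚ := fun i => Matrix.reindex e e (Matrix.blockDiagonal (B i))
  -- evaluation at `M` is the reindexed block-diagonal of the blockwise evaluations
  have hev : ∀ g : MonoidAlgebra ℚ (FreeMonoid (Fin n)),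
      MonoidAlgebra.lift ℚ (Matrix (Fin d) (Fin d) ℚ) (FreeMonoid (Fin n)) (FreeMonoid.lift M) g =
        Matrix.reindex e e (Matrix.blockDiagonal fun b =>
          MonoidAlgebra.lift ℚ (Matrix (Fin 2) (Fin 2) ℚ) (FreeMonoid (Fin n)) (FreeMonoid.lift fun i => B i b) g) := by
    intro g
    show MonoidAlgebra.lift ℚ (Matrix (Fin d) (Fin d) ℚ) (FreeMonoid (Fin n))
      (FreeMonoid.lift fun i => Matrix.reindex e e (Matrix.blockDiagonal (B i))) g = _
    rw [lift_reindex, lift_blockDiagonal]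
  refine ⟨ℚ, inferInstance, inferInstance, d, 4, M, ?_, le_rfl, ?_⟩
  · -- axioms have rank ≤ 4
    intro g hg
    rcases hg with ⟨i, rfl⟩ | ⟨i, j, hij, rfl⟩
    · -- Boolean axiom: identically zero
      rw [hev, Matrix.rank_reindex]
      have h0 : (fun b => MonoidAlgebra.lift ℚ (Matrix (Fin 2) (Fin 2) ℚ) (FreeMonoid (Fin n))
          (FreeMonoid.lift fun i => B i b) (X ℚ i * X ℚ i - X ℚ i)) = fun b => 0 := by
        funext b; simp [X, hBidem i b]
      rw [h0]
      have : (Matrix.blockDiagonal fun _ : o => (0 : Matrix (Fin 2) (Fin 2) ℚ)) = 0 := Matrix.blockDiagonal_zero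
      rw [this, Matrix.rank_zero]; exact Nat.zero_le _
    · -- commutator axiom: supported on the two blocks `(i,j)`, `(j,i)`
      have hblk : (fun b => MonoidAlgebra.lift ℚ (Matrix (Fin 2) (Fin 2) ℚ) (FreeMonoid (Fin n))
          (FreeMonoid.lift fun i => B i b) (X ℚ i * X ℚ j - X ℚ j * X ℚ i)) =
          fun b => B i b * B j b - B j b * B i b := by
        funext b; simp [X]
      rw [hev, Matrix.rank_reindex, hblk, Literature.Barriers.ValiantsHypothesis.rank_blockDiagonal]
      let b₀ : o := ⟨(i, j), Finset.mem_offDiag.mpr ⟨Finset.mem_univ _, Finset.mem_univ _, hij⟩⟩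
      let b₁ : o := ⟨(j, i), Finset.mem_offDiag.mpr ⟨Finset.mem_univ _, Finset.mem_univ _, Ne.symm hij⟩⟩
      have hzero : ∀ b : o, b ≠ b₀ → b ≠ b₁ → B i b * B j b - B j b * B i b = 0 := by
        intro b hb0 hb1
        by_cases hi : i ≠ b.1.1 ∧ i ≠ b.1.2
        · rw [hBone i b hi.1 hi.2]; simp
        by_cases hj : j ≠ b.1.1 ∧ j ≠ b.1.2
        · rw [hBone j b hj.1 hj.2]; simp
        exfalso
        simp only [not_and_or, ne_eq, not_not] at hi hj
        have hb : b.1 = (i, j) ∨ b.1 = (j, i) := by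
          rcases hi with hi | hi <;> rcases hj with hj | hj
          · exact absurd (hi.trans hj.symm) hij
          · left; exact Prod.ext hi.symm hj.symm
          · right; exact Prod.ext hj.symm hi.symm
          · exact absurd (hi.trans hj.symm) hij
        rcases hb with hb | hb
        · exact hb0 (Subtype.ext hb)
        · exact hb1 (Subtype.ext hb)
      have hle : ∀ b : o, (B i b * B j b - B j b * B i b).rank ≤
          (if b = b₀ then 2 else 0) + (if b = b₁ then 2 else 0) := by
        intro b
        by_cases hb0 : b = b₀
        · subst hb0
          have := Matrix.rank_le_card_width (B i b₀ * B j b₀ - B j b₀ * B i b₀)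
          simp only [Fintype.card_fin] at this
          simp only [if_true]; omega
        by_cases hb1 : b = b₁
        · subst hb1
          have := Matrix.rank_le_card_width (B i b₁ * B j b₁ - B j b₁ * B i b₁)
          simp only [Fintype.card_fin] at this
          simp only [hb0, if_false, if_true]; omega
        rw [hzero b hb0 hb1, Matrix.rank_zero]; exact Nat.zero_le _
      calc ∑ b, (B i b * B j b - B j b * B i b).rank
          ≤ ∑ b : o, ((if b = b₀ then 2 else 0) + (if b = b₁ then 2 else 0)) := Finset.sum_le_sum fun b _ => hle b
        _ = 2 + 2 := by
            rw [Finset.sum_add_distrib, Finset.sum_ite_eq', Finset.sum_ite_eq']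
            simp
        _ = 4 := rfl
  · -- the clause product has rank ≥ n² - n
    rw [hev, Matrix.rank_reindex, Literature.Barriers.ValiantsHypothesis.rank_blockDiagonal]
    -- blockwise value: `W_b - W_b²` with `W_b ∈ {pq, qp}`
    have hval : ∀ b : o, MonoidAlgebra.lift ℚ (Matrix (Fin 2) (Fin 2) ℚ) (FreeMonoid (Fin n))
        (FreeMonoid.lift fun i => B i b)
        (clauseProduct ℚ (((List.finRange n).map fun i => [(i, true)]) ++
          [(List.finRange n).map fun i => (i, false)])) =
        ((List.finRange n).map fun i => B i b).prod -
          ((List.finRange n).map fun i => B i b).prod * ((List.finRange n).map fun i => B i b).prod := by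
      intro b
      rw [lift_clauseProduct]
      simp only [List.map_append, List.map_map, List.prod_append, List.map_cons, List.map_nil, List.prod_cons,
        List.prod_nil, mul_one, FreeMonoid.lift_eval_of, Function.comp_def, if_true, sub_sub_cancel,
        Bool.false_eq_true, if_false]
      rw [mul_sub, mul_one]
    have hW : ∀ b : o, ((List.finRange n).map fun i => B i b).prod = p * q ∨
        ((List.finRange n).map fun i => B i b).prod = q * p := by
      intro b
      exact prod_map_two_special (List.finRange n) b.1.1 b.1.2 (hne b) p q (List.nodup_finRange n)
        (List.mem_finRange _) (List.mem_finRange _)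
    have hrank1 : ∀ b : o, 1 ≤ (MonoidAlgebra.lift ℚ (Matrix (Fin 2) (Fin 2) ℚ) (FreeMonoid (Fin n))
        (FreeMonoid.lift fun i => B i b)
        (clauseProduct ℚ (((List.finRange n).map fun i => [(i, true)]) ++
          [(List.finRange n).map fun i => (i, false)]))).rank := by
      intro b
      rw [hval b]
      apply one_le_rank_of_ne_zero
      rcases hW b with h | h <;> rw [h]
      · exact pq_sub_sq_ne_zero
      · exact qp_sub_sq_ne_zero
    have hsum : n * n - n ≤ ∑ b : o, (MonoidAlgebra.lift ℚ (Matrix (Fin 2) (Fin 2) ℚ) (FreeMonoid (Fin n))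
        (FreeMonoid.lift fun i => B i b)
        (clauseProduct ℚ (((List.finRange n).map fun i => [(i, true)]) ++
          [(List.finRange n).map fun i => (i, false)]))).rank := by
      calc n * n - n = ∑ _b : o, 1 := by simp [hcard]
        _ ≤ _ := Finset.sum_le_sum fun b _ => hrank1 b
    have hnn : n ≤ n * n := Nat.le_mul_self n
    omega

end Summit.PneNP.PneNP.Theorems.CnfIdealGenLengthRankDefectRepresentationsQuadraticWitness
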